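import Summits.QuantumFields.BalabanUV.Beta.SpineRecursive

/-!
# `BalabanUV.Beta.WardLocusRecursiveEnd` — binder row D1, the WARD binder hW FOR THE RECURSIVELY-TYPED CANDIDATE FAMILY `SrecAt`:
# the row owner's Π_bm-co-dressed recursive family `JsRecBmAtOf` is Ward-transversal AT EVERY LEVEL from EXACTLY the W-side (L4), at the pin

HONEST FRAMING (cell charter, verbatim): «discharging `BetaPertH` makes Bałaban's UV stability UNCONDITIONAL — a real constructive-QFT
result; it is NOT the continuum limit and NOT the Clay problem.»  DERIVED cell leaf (pub-balaban β sub-cell, D1 formalisation swarm seat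
`b2b-balaban-beta-d1-formalise-leaf-10`, gen 2; sequel of `WardLocusRecursive`); kernel algebra over objects ALREADY in the tree, cited BY NAME — the
recursive family `WardLocusRecursive.SrecAt` (leaf-10, p211362) in the row owner's `JetData` packaging `SpineRooted.JsRec0AtOf` / `JsRecBmAtOf`
(an2-g16 `SpineRecursive`, decision (L3-D′): the wall-literal candidate v2.26); 0 def, no statement of Bałaban's papers typed, no `[cite:]` tag,
no `def … : Prop`; the colour pin stays the lead's ruling (R45); it instantiates NO binder of the β-function wall by itself.
NOT `BetaPertH`, NOT continuum, NOT Clay.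
HONEST DEPENDENCY (cell records, verbatim): «continuum YM on T⁴ ⇐ BetaPertH ∧ nine spine estimates (0/9 proved); BetaPertH ⇐ (D1) ∧ (D4) ∧
CAP+tail; G-an2-4 gates asym, D1 and NE2/3/4.»
ABSOLUTE RULE (cell charter, verbatim): «No internally-minted statement may enter as a cited fact. Every hypothesis is either kernel-proved in
this package or a verbatim quotation of a PUBLISHED theorem with page reference. The manuscript(s) under audit are NOT citable for their own
disputed steps — they are the thing under adjudication; programme-internal (2001/route/tribunal) claims are never citable.»

WHAT IS HERE.  an1-g25's GENERIC hW root `KernelWardRelativeEnd.wardTransversal_flipK_TbalOf_dressBmAt_rel` (any undressed step jets `Js`,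
in-block root, `𝕄 j`, `E` with `RelInv G_j (𝕄 j) E`, sockets hSt/hWt/hH/hX/hEX/hSd + the W-side) instantiated at the recursively-typed candidate
family: `Js := SpineRooted.JsRec0AtOf` (an2-g16's packaging; first-order tables `SrecAt (toSite r) cE cVH cΛ j`, second-order tables `W j`),
`𝕄 j := bhKStepAt 3 ρ Lc j`, `E := axEc ρ Lc`, `cH j := (stepScale j·Lc⁴)⁻¹`, generator `X j y := diagK ((cE·(1/2)/Lc⁴) • Σ_{v ∈ box} legInd ρ (Lc•y + v))`.
EVERY S-side socket is DISCHARGED BY NAME: `RelInv` ∀ j (an2 `relInv_coDressKBmAt_KInvStep_bhKStepAt`), hH ∀ j (leaf-07 `colH_ward_KInvStep_all`),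
hSt/hWt (`JsRec0AtOf_S_translate`/`_W_translate`), hX (an1-g26 `loc_diagK_smul_sum_legInd`), hEX (`comp_axEc_diagK_comm`),
**hSd ∀ j (`WardLocusRecursive.hSd_SrecAt_of_pin`)**.  RESULT `wardTransversal_flipK_TbalOf_JsRecBmAtOf`: at the Ward pin `cE = Lc⁴`,
`cVH = −cE·(1/2)·Lc⁴` (the hR hyperplane `2·cVH = −cE·Lc⁴`), for EVERY Λ-weight, EVERY in-block root, `Lc ≥ 1`:
**`∀ j, WardTransversal (flipK (TbalOf Lc (JsRecBmAtOf hLc hr cE cVH cΛ W Cw δw hδw hW) j))` ⟸ EXACTLY the W-side (L4)** — the second-order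
tables' block covariance `hWt` and their pure-gauge law `hWd` (+ remainder `Nr`, contact `X₂`, `hN0`) against the DETERMINED generators.
So for the recursive typing the hW binder is reduced to the supplier's second-order Ward law and the units ruling; nothing first-order remains.
-/

noncomputable section

open Finset
open scoped BigOperators
open Literature.MathematicalPhysics.QuantumFieldTheory
open Literature.MathematicalPhysics.QuantumFieldTheory.Balaban1983to89
open Literature.MathematicalPhysics.QuantumFieldTheory.Balaban1983to89.Beta
open B6BondElimination (unitVec)
open ExpKernelCalculus (MKer Decays BiLoc comp tadpole VertexFamily₂ shiftK)
open PolarizationSign (WardTransversal)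
open KernelWard (divV divW)
open AffineAveraging (box toSite)
open OneStepResolventKernel (Fib LocStencil JetData)
open OneStepKernelFamily (KInvStep colH vertexOfK TbalOf flipK)
open Summit.QuantumFields.BalabanUV.Beta.TameKernelCalculus
open Summit.QuantumFields.BalabanUV.Beta.ChartConjugation (conjV conjW)
open Summit.QuantumFields.BalabanUV.Beta.ChartConjugationRelative (RelInv)
open Summit.QuantumFields.BalabanUV.Beta.AxialDressingRooted (dressBmAt coDressKBmAt axEc spr_axEc)
open Summit.QuantumFields.BalabanUV.Beta.BorderedHessian (bhKStepAt stepScale diagK comp_axEc_diagK_comm spr_bhKStepAt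
  relInv_coDressKBmAt_KInvStep_bhKStepAt)
open Summit.QuantumFields.BalabanUV.Beta.AveragingWardRootedStencils (legInd)
open Summit.QuantumFields.BalabanUV.Beta.KernelWardRelativeEnd (wardTransversal_flipK_TbalOf_dressBmAt_rel)
open Summit.QuantumFields.BalabanUV.Beta.KernelWardHColumnWall (colH_ward_KInvStep_all)
open Summit.QuantumFields.BalabanUV.Beta.KernelWardLevels (loc_diagK_smul_sum_legInd)
open Summit.QuantumFields.BalabanUV.Beta.WardLocusRecursive (SrecAt hSd_SrecAt_of_pin)
open Summit.QuantumFields.BalabanUV.Beta.SpineRooted (JsRec0AtOf JsRecBmAtOf JsRec0AtOf_S_translate JsRec0AtOf_W_translate)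

namespace Summit.QuantumFields.BalabanUV.Beta.WardLocusRecursiveEnd

variable {d : ℕ} {Lc : ℕ} [NeZero Lc]

/-! ## hW for the co-dressed recursive family ⟸ the W-side only -/

section End

/-- [folklore] **THE WARD BINDER hW FOR THE Π_bm-CO-DRESSED RECURSIVE CANDIDATE FAMILY, FROM THE W-SIDE ALONE.**  `d = 3`, `Lc ≥ 1`, ANY
in-block root `ρ = toSite r`, the Ward pin `cE = Lc⁴`, `cVH = −cE·(1/2)·Lc⁴` (the hR hyperplane `2·cVH = −cE·Lc⁴`), ANY Λ-weight `cΛ`,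
second-order tables `W j` (abstract data with `VertexFamily₂` bounds).  HYPOTHESES = THE W-SIDE (L4) ONLY: block covariance `hWt` of the
tables, and their pure-gauge law `hWd` against `𝕄 j = bhKStepAt 3 ρ Lc j` with the DETERMINED generator
`X j y = diagK ((cE·(1/2)/Lc⁴) • Σ_{v ∈ box} legInd ρ (Lc•y + v))`, a localised `E`-commuting contact `X₂`, a localised remainder `Nr` with
vanishing `G_j`-tadpole (`hN0`).  CONCLUSION: `∀ j, WardTransversal (flipK (TbalOf Lc (JsRecBmAtOf hLc hr cE cVH cΛ W Cw δw hδw hW) j))`.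
Every first-order / resolvent socket of an1's generic root is discharged BY NAME (see the module docstring). -/
theorem wardTransversal_flipK_TbalOf_JsRecBmAtOf (hLc : 1 ≤ Lc) {r : Fin 4 → ℕ} (hr : r ∈ box 4 Lc) {cE cVH : ℝ} (cΛ : ℝ)
    (hcE : cE = (Lc : ℝ) ^ (3 + 1)) (hcVH : cVH = -(cE * (1 / 2) * (Lc : ℝ) ^ (3 + 1)))
    (W : ℕ → Fin 4 → (Fin 4 → ℤ) → Fin 4 → (Fin 4 → ℤ) → MKer 4 (Fib 3)) (Cw δw : ℕ → ℝ) (hδw : ∀ j, 0 < δw j)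
    (hW : ∀ j, VertexFamily₂ (W j) Lc (Cw j) (δw j))
    (hWt : ∀ (j : ℕ) (μ : Fin 4) (y : Fin 4 → ℤ) (ν : Fin 4) (y' t : Fin 4 → ℤ),
      W j μ (y + t) ν (y' + t) = shiftK (-((Lc : ℤ) • t)) (W j μ y ν y'))
    (X₂ Nr : ℕ → (Fin 4 → ℤ) → Fin 4 → (Fin 4 → ℤ) → MKer 4 (Fib 3)) (hX₂ : ∀ j y ν y', Loc (X₂ j y ν y'))
    (hNr : ∀ j y ν y', Loc (Nr j y ν y')) (hEX₂ : ∀ j y ν y', comp (axEc (toSite r) Lc) (X₂ j y ν y') = comp (X₂ j y ν y') (axEc (toSite r) Lc))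
    (hWd : ∀ (j : ℕ) (y : Fin 4 → ℤ) (ν : Fin 4) (y' : Fin 4 → ℤ),
      divW (W j) y ν y' =
        conjW (bhKStepAt 3 (toSite r) Lc j) 0
          (vertexOfK (coDressKBmAt (toSite r) Lc (KInvStep (d := 3) Lc j)) Lc (SrecAt 3 Lc (toSite r) cE cVH cΛ j) ν y')
          (diagK ((cE * (1 / 2) / (Lc : ℝ) ^ (3 + 1)) • ∑ v ∈ box 4 Lc, legInd (toSite r) ((Lc : ℤ) • y + toSite v))) 0
          (X₂ j y ν y') + Nr j y ν y')
    (hN0 : ∀ j y ν y', tadpole (coDressKBmAt (toSite r) Lc (KInvStep (d := 3) Lc j)) (Nr j y ν y') = 0) :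
    ∀ j : ℕ, WardTransversal (flipK (TbalOf Lc (JsRecBmAtOf (d := 3) hLc hr cE cVH cΛ W Cw δw hδw hW) j)) :=
  wardTransversal_flipK_TbalOf_dressBmAt_rel hr (JsRec0AtOf (d := 3) hLc hr cE cVH cΛ W Cw δw hδw hW) (fun j => bhKStepAt 3 (toSite r) Lc j)
    (axEc (toSite r) Lc) (spr_bhKStepAt hr) (spr_axEc _ _) (relInv_coDressKBmAt_KInvStep_bhKStepAt hr)
    (JsRec0AtOf_S_translate hLc hr cE cVH cΛ W Cw δw hδw hW) (JsRec0AtOf_W_translate hLc hr cE cVH cΛ W Cw δw hδw hW hWt)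
    (fun j => (stepScale 3 Lc j * (Lc : ℝ) ^ (3 + 1))⁻¹)
    (fun j y κ' u => colH_ward_KInvStep_all hr j y κ' u)
    (fun _ y => diagK ((cE * (1 / 2) / (Lc : ℝ) ^ (3 + 1)) • ∑ v ∈ box 4 Lc, legInd (toSite r) ((Lc : ℤ) • y + toSite v)))
    (fun _ y => loc_diagK_smul_sum_legInd Lc (toSite r) _ y) (fun _ _ => comp_axEc_diagK_comm _ _ _) X₂ Nr hX₂ hNr hEX₂
    (fun j y => hSd_SrecAt_of_pin hLc hr cΛ hcE hcVH j y) hWd hN0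

/-- [folklore] **THE SAME AT THE LITERAL PIN `(cE, cVH) = (Lc⁴, −Lc⁴·(1/2)·Lc⁴)`**, generator scale written `Lc⁴·(1/2)/Lc⁴` (= `1/2`). -/
theorem wardTransversal_flipK_TbalOf_JsRecBmAtOf_pin (hLc : 1 ≤ Lc) {r : Fin 4 → ℕ} (hr : r ∈ box 4 Lc) (cΛ : ℝ)
    (W : ℕ → Fin 4 → (Fin 4 → ℤ) → Fin 4 → (Fin 4 → ℤ) → MKer 4 (Fib 3)) (Cw δw : ℕ → ℝ) (hδw : ∀ j, 0 < δw j)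
    (hW : ∀ j, VertexFamily₂ (W j) Lc (Cw j) (δw j))
    (hWt : ∀ (j : ℕ) (μ : Fin 4) (y : Fin 4 → ℤ) (ν : Fin 4) (y' t : Fin 4 → ℤ),
      W j μ (y + t) ν (y' + t) = shiftK (-((Lc : ℤ) • t)) (W j μ y ν y'))
    (X₂ Nr : ℕ → (Fin 4 → ℤ) → Fin 4 → (Fin 4 → ℤ) → MKer 4 (Fib 3)) (hX₂ : ∀ j y ν y', Loc (X₂ j y ν y'))
    (hNr : ∀ j y ν y', Loc (Nr j y ν y')) (hEX₂ : ∀ j y ν y', comp (axEc (toSite r) Lc) (X₂ j y ν y') = comp (X₂ j y ν y') (axEc (toSite r) Lc))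
    (hWd : ∀ (j : ℕ) (y : Fin 4 → ℤ) (ν : Fin 4) (y' : Fin 4 → ℤ),
      divW (W j) y ν y' =
        conjW (bhKStepAt 3 (toSite r) Lc j) 0
          (vertexOfK (coDressKBmAt (toSite r) Lc (KInvStep (d := 3) Lc j)) Lc
            (SrecAt 3 Lc (toSite r) ((Lc : ℝ) ^ (3 + 1)) (-((Lc : ℝ) ^ (3 + 1) * (1 / 2) * (Lc : ℝ) ^ (3 + 1))) cΛ j) ν y')
          (diagK (((Lc : ℝ) ^ (3 + 1) * (1 / 2) / (Lc : ℝ) ^ (3 + 1)) • ∑ v ∈ box 4 Lc, legInd (toSite r) ((Lc : ℤ) • y + toSite v))) 0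
          (X₂ j y ν y') + Nr j y ν y')
    (hN0 : ∀ j y ν y', tadpole (coDressKBmAt (toSite r) Lc (KInvStep (d := 3) Lc j)) (Nr j y ν y') = 0) :
    ∀ j : ℕ, WardTransversal (flipK (TbalOf Lc
      (JsRecBmAtOf (d := 3) hLc hr ((Lc : ℝ) ^ (3 + 1)) (-((Lc : ℝ) ^ (3 + 1) * (1 / 2) * (Lc : ℝ) ^ (3 + 1))) cΛ W Cw δw hδw hW) j)) :=
  wardTransversal_flipK_TbalOf_JsRecBmAtOf hLc hr cΛ rfl rfl W Cw δw hδw hW hWt X₂ Nr hX₂ hNr hEX₂ hWd hN0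

end End

/-! ## v1.1 (append-only) — the PARITY form: the scalar remainder socket `hN0` replaced by the structural `hNt` (an1's ROOT′ design) -/

section Parity

open Summit.QuantumFields.BalabanUV.Beta.BorderedHessian (sgnK)
open Summit.QuantumFields.BalabanUV.Beta.AxialDressingRooted (decays_coDressKBmAt_KInvStep)
open Summit.QuantumFields.BalabanUV.Beta.BubbleParity (spr_of_decays trK_coDressKBmAt_KInvStep)
open Summit.QuantumFields.BalabanUV.Beta.KernelWardRelativeEnd (tadpole_eq_zero_of_parity)

/-- [folklore] **hW FOR THE RECURSIVE LITERAL, PARITY FORM** (an1-g25's ROOT′ discipline, SKELETON-D1-hW v1 §2 (W-L4) TYPING NOTE): the scalar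
remainder socket `hN0 : tadpole G_j (Nr …) = 0` of `wardTransversal_flipK_TbalOf_JsRecBmAtOf` is replaced by the STRUCTURAL parity
`hNt : trK (Nr j y ν y′) = −sgnK (Nr j y ν y′)` (the stripped rotated first-order vertex is sgn-antisymmetric), discharged inside by
`KernelWardRelativeEnd.tadpole_eq_zero_of_parity` — the step propagators `G_j` being sgn-symmetric (`BubbleParity.trK_coDressKBmAt_KInvStep`).
This excludes the degenerate reading `X₂ := 0`, `Nr := divW W − conjW …` of the pair (`hWd`, `hN0`). -/
theorem wardTransversal_flipK_TbalOf_JsRecBmAtOf_parity (hLc : 1 ≤ Lc) {r : Fin 4 → ℕ} (hr : r ∈ box 4 Lc) {cE cVH : ℝ} (cΛ : ℝ)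
    (hcE : cE = (Lc : ℝ) ^ (3 + 1)) (hcVH : cVH = -(cE * (1 / 2) * (Lc : ℝ) ^ (3 + 1)))
    (W : ℕ → Fin 4 → (Fin 4 → ℤ) → Fin 4 → (Fin 4 → ℤ) → MKer 4 (Fib 3)) (Cw δw : ℕ → ℝ) (hδw : ∀ j, 0 < δw j)
    (hW : ∀ j, VertexFamily₂ (W j) Lc (Cw j) (δw j))
    (hWt : ∀ (j : ℕ) (μ : Fin 4) (y : Fin 4 → ℤ) (ν : Fin 4) (y' t : Fin 4 → ℤ),
      W j μ (y + t) ν (y' + t) = shiftK (-((Lc : ℤ) • t)) (W j μ y ν y'))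
    (X₂ Nr : ℕ → (Fin 4 → ℤ) → Fin 4 → (Fin 4 → ℤ) → MKer 4 (Fib 3)) (hX₂ : ∀ j y ν y', Loc (X₂ j y ν y'))
    (hNr : ∀ j y ν y', Loc (Nr j y ν y')) (hEX₂ : ∀ j y ν y', comp (axEc (toSite r) Lc) (X₂ j y ν y') = comp (X₂ j y ν y') (axEc (toSite r) Lc))
    (hWd : ∀ (j : ℕ) (y : Fin 4 → ℤ) (ν : Fin 4) (y' : Fin 4 → ℤ),
      divW (W j) y ν y' =
        conjW (bhKStepAt 3 (toSite r) Lc j) 0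
          (vertexOfK (coDressKBmAt (toSite r) Lc (KInvStep (d := 3) Lc j)) Lc (SrecAt 3 Lc (toSite r) cE cVH cΛ j) ν y')
          (diagK ((cE * (1 / 2) / (Lc : ℝ) ^ (3 + 1)) • ∑ v ∈ box 4 Lc, legInd (toSite r) ((Lc : ℤ) • y + toSite v))) 0
          (X₂ j y ν y') + Nr j y ν y')
    (hNt : ∀ j y ν y', trK (Nr j y ν y') = -sgnK (Nr j y ν y')) :
    ∀ j : ℕ, WardTransversal (flipK (TbalOf Lc (JsRecBmAtOf (d := 3) hLc hr cE cVH cΛ W Cw δw hδw hW) j)) :=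
  wardTransversal_flipK_TbalOf_JsRecBmAtOf hLc hr cΛ hcE hcVH W Cw δw hδw hW hWt X₂ Nr hX₂ hNr hEX₂ hWd
    fun j y ν y' => tadpole_eq_zero_of_parity (spr_of_decays (decays_coDressKBmAt_KInvStep hr j))
      (trK_coDressKBmAt_KInvStep hr j) (hNr j y ν y') (hNt j y ν y')

end Parity

end Summit.QuantumFields.BalabanUV.Beta.WardLocusRecursiveEnd

end
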